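import Summits.ValiantsHypothesis.ValiantsHypothesis.Theorems.BarrierLeverAnchoredDoorHitsLowerPairsStarLabelling
import Summits.ValiantsHypothesis.ValiantsHypothesis.Theorems.BarrierLeverAnchoredDoorHitsLowerPairsStarArrow

/-!
# Route BarrierLever — support item `AnchoredDoorHitsLowerPairs` (stmt-ValiantsHypothesis-22510), line `anchored_peeling`:
# THE HYBRID LABELLING CERTIFICATE — column labels against a numeric row side (val-np-p1 g33)

The ONE-SIDED HYBRID form of the star labelling principle (…StarLabelling, same session): the COLUMN vertices `e` carry labels
`B e ⊆ X` (faces of the row side; `∅` = unlabelled) and become rigid centres whose leaf set is exactly `B e`, while the ROW vertices keep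
honest numeric centre weights `dh b e`. On the one-parameter family
  `g b e = [b ∈ B e] · X`,   `d b e = dh b e · X ^ |B e|`
every star-forest entry `starEntry g d A S` has degree `≤ potH B S = Σ_{e ∈ S} |B e|` (a bound depending on the COLUMN only) and its top
coefficient is the complex number `hybTop B dh A S` (`coeff_starEntry_hyb`) — combinatorially
  `hybTop B dh A S = Σ_{T ⊆ S labelled, B(T) := ⊔_{e∈T} B e ⊆ A disjoint} ∏_{e ∈ S ∖ T} ([e unlabelled] + Σ_{b ∈ A ∖ B(T)} dh b e)`,
the star sum in which every labelled column CENTRE carries exactly its label and the row centres weigh their column leaves by `dh`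
(isolated row centres allowed — the normalisation of `starEntry`). Hence (`starDet_ne_zero_of_hybrid`): if for SOME numeric `dh` the matrix
`(hybTop B dh (u i) (w j))` is nonsingular, some complex weights make the star-forest block of `(u, w)` nonsingular — no lower-set, injectivity
or balance hypothesis; `_swap` is the mirror form (row labels, numeric column side). With `B = ∅` everywhere this is the transposed evaluation
certificate (…StarFaces `starDet_ne_zero_of_evalDet_swap`); with `dh = 0` it is the column half of the pure labelling principle. MECHANISM: the
torus degeneration `y_e ↦ t^{-|B e|} y_e` (rows unscaled) of the zeon tensor.

WHY THIS FILE. The pure labelling certificate is NOT universal (no labelling exists for `(2^{[4]}, B(5,2))` or `(K₅, K_{1,6} ⊔ 2K₂)`), and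
the evaluation certificates fail on the parity accidents; the hybrid certificate found (lab/hybrid1.py, HOME/val-np-p1/g33) a witness, in
milliseconds, for EVERY named hard pair of the line in BOTH orientations — parity `(K_{1,4}, C₄⊔pt)`, the degree accident `(K₅, K_{1,6}⊔2K₂)`,
the `K_{2,6}` circuit pair, the rigid family `(K_{1,4m−2} ⊔ K₂, m·C₄)` (`m = 2, 3`), `(2^{[4]}, B(5,2))`, … — and is the census device of
record of this generation (kit j336349). CONJECTURE HC (memo §4): every lower pair has a hybrid certificate in some orientation; in the
polynomial picture it is a HERMITE INTERPOLATION statement (labels = derivative orders at the subset-sum nodes). It does NOT prove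
`Stmt.conjStarLower`; nothing here bears on crux 14610 or on `VP ≠ VNP`.
-/

set_option linter.dupNamespace false

namespace Summit.ValiantsHypothesis.ValiantsHypothesis.Theorems.BarrierLever.AnchoredPeeling

open Finset Polynomial

noncomputable section

namespace StarDoor

variable {h : ℕ}

/-! ## 1. The hybrid family and its top matrix -/

section Defs

variable (B : Fin h → Finset (Fin h)) (dh : Fin h → Fin h → ℂ)

/-- Row-leaf weights of the hybrid family: `b` hangs from the column centre `e` only if `b ∈ B e`, with weight `X`. -/
def gHyb (b e : Fin h) : ℂ[X] := if b ∈ B e then X else 0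

/-- Column-leaf weights of the hybrid family: the numeric weight `dh b e` scaled by `X ^ |B e|`. -/
def dHyb (b e : Fin h) : ℂ[X] := C (dh b e) * X ^ (B e).card

/-- The column potential: total label size of the column. -/
def potH (S : Finset (Fin h)) : ℕ := ∑ e ∈ S, (B e).card

/-- Degree of the `(A', S')`-summand on the hybrid family. -/
def hybDeg (A S A' S' : Finset (Fin h)) : ℕ := (A \ A').card + ∑ e ∈ S \ S', (B e).card

/-- The combinatorial factor of the `(A', S')`-summand: number of ways of hanging the row leaves on labelled column centres. -/
def hybWays (A A' S' : Finset (Fin h)) : ℕ := ∏ b ∈ A \ A', (S'.filter (fun e => b ∈ B e)).card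

/-- Coefficient of the `(A', S')`-summand on the hybrid family. -/
def hybCoef (A S A' S' : Finset (Fin h)) : ℂ := (hybWays B A A' S' : ℂ) * ∏ e ∈ S \ S', ∑ b ∈ A', dh b e

/-- **The hybrid top entry** `hybTop B dh A S`: the `X^{potH B S}`-coefficient of `starEntry` on the hybrid family (`coeff_starEntry_hyb`). -/
def hybTop (A S : Finset (Fin h)) : ℂ :=
  ∑ A' ∈ A.powerset, ∑ S' ∈ S.powerset, if hybDeg B A S A' S' = potH B S then hybCoef B dh A S A' S' else 0

end Defs

/-! ## 2. Summands are monomials; degree bound; top coefficient -/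

section Entry

variable (B : Fin h → Finset (Fin h)) (dh : Fin h → Fin h → ℂ)

/-- A row leaf `b` against the column centres `S'` on the hybrid family: `#{e ∈ S' : b ∈ B e} · X`. -/
theorem sum_gHyb (b : Fin h) (S' : Finset (Fin h)) :
    ∑ e ∈ S', gHyb B b e = ((S'.filter (fun e => b ∈ B e)).card : ℂ[X]) * X ^ 1 := by
  classical
  unfold gHyb
  rw [← Finset.sum_filter, Finset.sum_const, nsmul_eq_mul, pow_one]

/-- A column leaf `e` against the row centres `A'` on the hybrid family: `(Σ_{b ∈ A'} dh b e) · X^{|B e|}`. -/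
theorem sum_dHyb (e : Fin h) (A' : Finset (Fin h)) :
    ∑ b ∈ A', dHyb B dh b e = C (∑ b ∈ A', dh b e) * X ^ (B e).card := by
  unfold dHyb
  rw [map_sum, Finset.sum_mul]

/-- A product of monomials `(C a_i · X^{k_i})` is the monomial `C (∏ a_i) · X^{Σ k_i}`. -/
theorem prod_C_mul_X_pow_hyb {ι : Type*} (s : Finset ι) (a : ι → ℂ) (k : ι → ℕ) :
    ∏ i ∈ s, (C (a i) * X ^ (k i)) = C (∏ i ∈ s, a i) * X ^ (∑ i ∈ s, k i) := by
  rw [Finset.prod_mul_distrib, Finset.prod_pow_eq_pow_sum, map_prod]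

/-- **The `(A', S')`-summand on the hybrid family is the monomial `hybCoef · X^{hybDeg}`.** -/
theorem starTerm_hyb (A S A' S' : Finset (Fin h)) :
    (∏ b ∈ A \ A', ∑ e ∈ S', gHyb B b e) * (∏ e ∈ S \ S', ∑ b ∈ A', dHyb B dh b e)
      = C (hybCoef B dh A S A' S') * X ^ (hybDeg B A S A' S') := by
  simp_rw [sum_gHyb, sum_dHyb]
  have h1 : ∏ b ∈ A \ A', (((S'.filter (fun e => b ∈ B e)).card : ℂ[X]) * X ^ 1)
      = C ((hybWays B A A' S' : ℕ) : ℂ) * X ^ ((A \ A').card) := by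
    have : ∀ b ∈ A \ A', (((S'.filter (fun e => b ∈ B e)).card : ℂ[X]) * X ^ 1)
        = C (((S'.filter (fun e => b ∈ B e)).card : ℕ) : ℂ) * X ^ 1 := fun b _ => by rw [map_natCast]
    rw [Finset.prod_congr rfl this, prod_C_mul_X_pow_hyb]
    unfold hybWays
    rw [Nat.cast_prod, Finset.sum_const, smul_eq_mul, mul_one]
  rw [h1, prod_C_mul_X_pow_hyb]
  unfold hybCoef hybDeg
  rw [map_mul, pow_add]
  ring

/-- **`starEntry` on the hybrid family is the sum of the monomials `hybCoef · X^{hybDeg}`.** -/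
theorem starEntry_hyb_eq (A S : Finset (Fin h)) :
    starEntry (gHyb B) (dHyb B dh) A S
      = ∑ A' ∈ A.powerset, ∑ S' ∈ S.powerset, C (hybCoef B dh A S A' S') * X ^ (hybDeg B A S A' S') := by
  unfold starEntry
  exact Finset.sum_congr rfl fun A' _ => Finset.sum_congr rfl fun S' _ => starTerm_hyb B dh A S A' S'

/-- **Degree bound for a summand** with nonzero combinatorial factor. -/
theorem hybDeg_le_potH {A S A' S' : Finset (Fin h)} (hS' : S' ⊆ S) (hw : hybWays B A A' S' ≠ 0) :
    hybDeg B A S A' S' ≤ potH B S := by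
  classical
  unfold hybWays at hw
  have hc1 : ∀ b ∈ A \ A', (S'.filter (fun e => b ∈ B e)).card ≠ 0 := by
    intro b hb h0
    exact hw (Finset.prod_eq_zero hb h0)
  have h1 : (A \ A').card ≤ ∑ e ∈ S', (B e).card := card_le_sum_card_of_covered B (A \ A') S' hc1
  have hsplitS : ∑ e ∈ S, (B e).card = ∑ e ∈ S \ S', (B e).card + ∑ e ∈ S', (B e).card := (Finset.sum_sdiff hS').symm
  unfold hybDeg potH
  rw [hsplitS]
  omega

/-- **Degree bound:** `starEntry` on the hybrid family has degree at most the column potential. -/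
theorem natDegree_starEntry_hyb_le (A S : Finset (Fin h)) :
    (starEntry (gHyb B) (dHyb B dh) A S).natDegree ≤ potH B S := by
  classical
  rw [starEntry_hyb_eq]
  refine natDegree_sum_le_of_forall_le _ _ fun A' _ => natDegree_sum_le_of_forall_le _ _ fun S' hS' => ?_
  by_cases hw : hybWays B A A' S' = 0
  · have : hybCoef B dh A S A' S' = 0 := by unfold hybCoef; rw [hw, Nat.cast_zero, zero_mul]
    rw [this, map_zero, zero_mul, natDegree_zero]; exact Nat.zero_le _
  · exact (natDegree_C_mul_X_pow_le _ _).trans (hybDeg_le_potH B (Finset.mem_powerset.mp hS') hw)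

/-- **Top coefficient:** the `X^{potH B S}`-coefficient of `starEntry` on the hybrid family is `hybTop B dh A S`. -/
theorem coeff_starEntry_hyb (A S : Finset (Fin h)) :
    (starEntry (gHyb B) (dHyb B dh) A S).coeff (potH B S) = hybTop B dh A S := by
  classical
  rw [starEntry_hyb_eq, finsetSum_coeff]
  unfold hybTop
  refine Finset.sum_congr rfl fun A' _ => ?_
  rw [finsetSum_coeff]
  refine Finset.sum_congr rfl fun S' _ => ?_
  rw [coeff_C_mul_X_pow]
  by_cases hdeg : hybDeg B A S A' S' = potH B S
  · rw [if_pos hdeg.symm, if_pos hdeg]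
  · rw [if_neg (fun h' => hdeg h'.symm), if_neg hdeg]

end Entry

/-! ## 3. The hybrid certificate -/

section Principle

variable {r : ℕ} (u w : Fin r → Finset (Fin h)) (B : Fin h → Finset (Fin h)) (dh : Fin h → Fin h → ℂ)

/-- **THE HYBRID LABELLING CERTIFICATE.** For ANY row and column families `u w` (no lower-set, injectivity or balance hypothesis), ANY column
labels `B` and ANY numeric row-side weights `dh`: if the complex matrix `(hybTop B dh (u i) (w j))_{i j}` is nonsingular, then some complex
weights make the star-forest block `(starEntry g d (u i) (w j))` nonsingular. -/
theorem starDet_ne_zero_of_hybrid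
    (hN : (Matrix.of fun i j : Fin r => hybTop B dh (u i) (w j)).det ≠ 0) :
    ∃ g d : Fin h → Fin h → ℂ, (Matrix.of fun i j : Fin r => starEntry g d (u i) (w j)).det ≠ 0 := by
  classical
  let c : Fin r → ℕ := fun j => potH B (w j)
  let Kc : ℕ := ∑ j, c j
  have hc : ∀ j, c j ≤ Kc := fun j => Finset.single_le_sum (f := c) (fun j _ => Nat.zero_le _) (Finset.mem_univ j)
  let MP : Matrix (Fin r) (Fin r) ℂ[X] := Matrix.of fun i j => starEntry (gHyb B) (dHyb B dh) (u i) (w j)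
  let MS : Matrix (Fin r) (Fin r) ℂ[X] := Matrix.of fun i j => MP i j * X ^ (Kc - c j)
  have hdeg : ∀ i j, (MS i j).natDegree ≤ Kc := by
    intro i j
    simp only [MS, MP, Matrix.of_apply]
    calc (starEntry (gHyb B) (dHyb B dh) (u i) (w j) * X ^ (Kc - c j)).natDegree
        ≤ (starEntry (gHyb B) (dHyb B dh) (u i) (w j)).natDegree + (X ^ (Kc - c j) : ℂ[X]).natDegree := natDegree_mul_le
      _ ≤ c j + (Kc - c j) := by
          gcongr
          · exact natDegree_starEntry_hyb_le B dh (u i) (w j)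
          · exact natDegree_X_pow_le _
      _ = Kc := by have := hc j; omega
  have hcoefMS : (MS.map fun p => p.coeff Kc) = Matrix.of fun i j : Fin r => hybTop B dh (u i) (w j) := by
    ext i j
    simp only [MS, MP, Matrix.map_apply, Matrix.of_apply]
    rw [coeff_mul_X_pow', if_pos (Nat.sub_le _ _), Nat.sub_sub_self (hc j)]
    exact coeff_starEntry_hyb B dh (u i) (w j)
  have hcoef : (MS.det).coeff (Fintype.card (Fin r) * Kc) = (Matrix.of fun i j : Fin r => hybTop B dh (u i) (w j)).det := by
    rw [Literature.AlgebraicGeometry.DeterminantalHypersurfaces.coeff_det_of_natDegree_le MS Kc hdeg, hcoefMS]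
  have hMS : MS.det ≠ 0 := by
    intro h0
    apply hN
    rw [← hcoef, h0, coeff_zero]
  have hMSeq : MS = MP * Matrix.diagonal (fun j => (X : ℂ[X]) ^ (Kc - c j)) := by
    ext i j
    simp only [MS, Matrix.of_apply, Matrix.mul_diagonal]
  have hMP : MP.det ≠ 0 := by
    intro h0
    apply hMS
    rw [hMSeq, Matrix.det_mul, h0, zero_mul]
  have hex : ∃ t : ℂ, ¬ (MP.det).IsRoot t := by
    by_contra hall
    push Not at hall
    apply hMP
    apply Polynomial.eq_zero_of_infinite_isRoot
    have huniv : {x : ℂ | (MP.det).IsRoot x} = Set.univ := Set.eq_univ_of_forall fun x => hall x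
    rw [huniv]
    exact Set.infinite_univ
  obtain ⟨t, ht⟩ := hex
  refine ⟨fun b e => Polynomial.eval t (gHyb B b e), fun b e => Polynomial.eval t (dHyb B dh b e), ?_⟩
  have hev : Polynomial.eval t MP.det =
      (Matrix.of fun i j : Fin r => starEntry (fun b e => Polynomial.eval t (gHyb B b e))
        (fun b e => Polynomial.eval t (dHyb B dh b e)) (u i) (w j)).det := by
    rw [← Polynomial.coe_evalRingHom, RingHom.map_det, RingHom.mapMatrix_apply]
    congr 1; ext i j; simp only [MP, Matrix.map_apply, Matrix.of_apply]; rw [map_starEntry]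
  rw [← hev]
  exact ht

/-- **The hybrid certificate, mirror form:** labels `W` on the ROW vertices (sets of column vertices) against numeric COLUMN-side weights
`gh` (the weight of the row leaf `b` on the column centre `e`). -/
theorem starDet_ne_zero_of_hybrid_swap (W : Fin h → Finset (Fin h)) (gh : Fin h → Fin h → ℂ)
    (hN : (Matrix.of fun i j : Fin r => hybTop W (fun e b => gh b e) (w j) (u i)).det ≠ 0) :
    ∃ g d : Fin h → Fin h → ℂ, (Matrix.of fun i j : Fin r => starEntry g d (u i) (w j)).det ≠ 0 := by
  have hN' : (Matrix.of fun j i : Fin r => hybTop W (fun e b => gh b e) (w j) (u i)).det ≠ 0 := by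
    have hmat : (Matrix.of fun j i : Fin r => hybTop W (fun e b => gh b e) (w j) (u i))
        = (Matrix.of fun i j : Fin r => hybTop W (fun e b => gh b e) (w j) (u i)).transpose := by
      ext i j; rfl
    rw [hmat, Matrix.det_transpose]; exact hN
  obtain ⟨g', d', hdet⟩ := starDet_ne_zero_of_hybrid w u W (fun e b => gh b e) hN'
  refine ⟨fun b e => d' e b, fun b e => g' e b, ?_⟩
  have hmat : (Matrix.of fun i j : Fin r => starEntry (fun b e => d' e b) (fun b e => g' e b) (u i) (w j))
      = (Matrix.of fun i j : Fin r => starEntry g' d' (w i) (u j)).transpose := by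
    ext i j
    simp only [Matrix.of_apply, Matrix.transpose_apply]
    rw [starEntry_swap]
  rw [hmat, Matrix.det_transpose]
  exact hdet

/-- **The hybrid certificate at the door level:** an injective lower pair with a nonsingular hybrid matrix has `symbolicDet 2 ≠ 0`. -/
theorem symbolicDet_two_ne_zero_of_hybrid (hu : Function.Injective u) (hw : Function.Injective w)
    (hlu : IsLowerSet (Set.range u)) (hlw : IsLowerSet (Set.range w))
    (hN : (Matrix.of fun i j : Fin r => hybTop B dh (u i) (w j)).det ≠ 0) :
    symbolicDet 2 h r u w ≠ 0 := by
  obtain ⟨g, d, hdet⟩ := starDet_ne_zero_of_hybrid u w B dh hN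
  exact symbolicDet_two_ne_zero_of_starDet g d u w hu hw hlu hlw hdet

/-- **… mirror form at the door level.** -/
theorem symbolicDet_two_ne_zero_of_hybrid_swap (hu : Function.Injective u) (hw : Function.Injective w)
    (hlu : IsLowerSet (Set.range u)) (hlw : IsLowerSet (Set.range w)) (W : Fin h → Finset (Fin h)) (gh : Fin h → Fin h → ℂ)
    (hN : (Matrix.of fun i j : Fin r => hybTop W (fun e b => gh b e) (w j) (u i)).det ≠ 0) :
    symbolicDet 2 h r u w ≠ 0 := by
  obtain ⟨g, d, hdet⟩ := starDet_ne_zero_of_hybrid_swap u w W gh hN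
  exact symbolicDet_two_ne_zero_of_starDet g d u w hu hw hlu hlw hdet

/-- **… as an anchored hit at profile 2.** -/
theorem anchoredHit_two_of_hybrid (hu : Function.Injective u) (hw : Function.Injective w)
    (hlu : IsLowerSet (Set.range u)) (hlw : IsLowerSet (Set.range w))
    (hN : (Matrix.of fun i j : Fin r => hybTop B dh (u i) (w j)).det ≠ 0) :
    AnchoredHit 2 h r u w :=
  stub_genericPoint 2 h r u w (symbolicDet_two_ne_zero_of_hybrid u w B dh hu hw hlu hlw hN)

/-- **… mirror form as an anchored hit at profile 2.** -/
theorem anchoredHit_two_of_hybrid_swap (hu : Function.Injective u) (hw : Function.Injective w)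
    (hlu : IsLowerSet (Set.range u)) (hlw : IsLowerSet (Set.range w)) (W : Fin h → Finset (Fin h)) (gh : Fin h → Fin h → ℂ)
    (hN : (Matrix.of fun i j : Fin r => hybTop W (fun e b => gh b e) (w j) (u i)).det ≠ 0) :
    AnchoredHit 2 h r u w :=
  stub_genericPoint 2 h r u w (symbolicDet_two_ne_zero_of_hybrid_swap u w hu hw hlu hlw W gh hN)

end Principle

end StarDoor

end

end Summit.ValiantsHypothesis.ValiantsHypothesis.Theorems.BarrierLever.AnchoredPeeling
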